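import Summits.NavierStokesRegularity.FluidComputer.PalasekTowerTinyBlobStrainExplicit
import Summits.HubbardSuperconductivity.HubbardSuperconductivity.Theorems.KLProgrammeSalmhoferCutoffDerivBound

/-!
# The tiny blob, VII: NUMERIC second-derivative bounds of the radial profile — `|j′| ≤ 8`, `|G′| ≤ 18`

Cell `ns-blowup`, seat `ns-blowup-ecbridge-3` (g5); GROUP C «BRIDGE SUPPORT» of the route
`PalasekTowerBreakdown` (crux `EpisodeBaseG`, item stmt-NavierStokesRegularity-19179, R2). Sequel of
`PalasekTowerTinyBlobProfile.lean` (ecbridge-4 g3: `jcut t = 1 − S(t − 1/2)`, `mramp = ∫ jcut`, `etaProf`,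
`blobG = etaProf′`, `blobF`). LABEL: E–C typing (KERNEL, one-variable calculus, proofs only). WHAT THIS IS NOT:
not Navier–Stokes evidence — derivative bounds of Mathlib's smooth transition function; no flow, stage or schedule.

## Why

Every explicit profile of the slot files (the tiny blob, the far pusher's potential, the decorated blobs) is
built on `Real.smoothTransition` `S`, of which Mathlib records smoothness, monotonicity and `0 ≤ S ≤ 1` but no
numeric derivative bound; any sup norm of a SECOND derivative of these profiles (the numbers `w`, `e`, `f`, `M` of
`PalasekTowerGermHostExplicitBounds` / `…NearField`) needs one. The tree already holds `|S′| ≤ 8` (proved for the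
Kohn–Luttinger programme: `Summit.HubbardSuperconductivity.HubbardSuperconductivity.Theorems.KLRegimeSplit.
klcd_abs_deriv_smoothTransition_le_eight`, imported and REUSED here rather than restated); this file draws the two
consequences the blob calculus needs:

* `hasDerivAt_jcut` / `deriv_jcut` (`j′(t) = −S′(t − 1/2)`), **`abs_deriv_jcut_le`** (`|j′| ≤ 8`);
* `hasDerivAt_blobG` (`G′ = (−6 + 12m) j² + (−6m + 6m²) j′`), **`abs_deriv_blobG_le`** (`|G′(σ)| ≤ 18` for
  `σ ≥ 0`), `abs_deriv_blobG_le_of_lt_half` (`≤ 6` on the flat zone).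

References: folklore real analysis (the standard `C^∞` partition-of-unity step); serves S. Palasek,
arXiv:2605.13827 §3.3 [cite: Palasek2026ElementaryModel, §3.3].
-/

noncomputable section

namespace Summit.NavierStokesRegularity.FluidComputer.PalasekTowerClayBridge.TinyBlob

open Set Function Filter Topology Real
open scoped Topology

/-! ## §1 Consequences of `|S′| ≤ 8` for the blob profile: `|j′| ≤ 8`, `|G′| ≤ 18` -/

/-- `j′(t) = −S′(t − 1/2)`. [folklore] -/
theorem hasDerivAt_jcut (t : ℝ) : HasDerivAt jcut (-deriv Real.smoothTransition (t - 1 / 2)) t := by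
  have hd : DifferentiableAt ℝ Real.smoothTransition (t - 1 / 2) :=
    ((Real.smoothTransition.contDiff (n := 1)).differentiable one_ne_zero) _
  have h := (hd.hasDerivAt.comp t ((hasDerivAt_id t).sub_const (1 / 2))).const_sub 1
  show HasDerivAt (fun x => 1 - (Real.smoothTransition ∘ fun x => id x - 1 / 2) x) _ t
  exact h.congr_deriv (by simp)

/-- `deriv j t = −S′(t − 1/2)`. [folklore] -/
theorem deriv_jcut (t : ℝ) : deriv jcut t = -deriv Real.smoothTransition (t - 1 / 2) :=
  (hasDerivAt_jcut t).deriv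

/-- **`|j′| ≤ 8`.** [folklore] -/
theorem abs_deriv_jcut_le (t : ℝ) : |deriv jcut t| ≤ 8 := by
  rw [deriv_jcut, abs_neg]
  exact Summit.HubbardSuperconductivity.HubbardSuperconductivity.Theorems.KLRegimeSplit.klcd_abs_deriv_smoothTransition_le_eight _

/-- **The derivative of `G`**: `G′ = (−6 + 12m) j² + (−6m + 6m²) j′` (`m′ = j`). [folklore] -/
theorem hasDerivAt_blobG (σ : ℝ) :
    HasDerivAt blobG ((-6 + 12 * mramp σ) * jcut σ * jcut σ +
      (-6 * mramp σ + 6 * mramp σ ^ 2) * deriv jcut σ) σ := by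
  have hm := hasDerivAt_mramp σ
  have hj : HasDerivAt jcut (deriv jcut σ) σ := (hasDerivAt_jcut σ).differentiableAt.hasDerivAt
  have hp : HasDerivAt (fun s => -6 * mramp s + 6 * mramp s ^ 2) (-6 * jcut σ + 6 * (2 * mramp σ * jcut σ)) σ := by
    have h1 := hm.const_mul (-6)
    have h2 := (hm.pow 2).const_mul 6
    have h := h1.add h2
    refine h.congr_deriv ?_
    simp only [Nat.cast_ofNat]
    ring
  have h := hp.mul hj
  have hfun : blobG = fun s => (-6 * mramp s + 6 * mramp s ^ 2) * jcut s := rfl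
  rw [hfun]
  refine h.congr_deriv ?_
  ring

/-- **`|G′(σ)| ≤ 18` for `σ ≥ 0`** (`m ∈ [0, 1]`, `j ∈ [0, 1]`, `|j′| ≤ 8`: `|(−6 + 12m)j²| ≤ 6`,
`|(−6m + 6m²)j′| ≤ (3/2)·8`). [folklore] -/
theorem abs_deriv_blobG_le {σ : ℝ} (hσ : 0 ≤ σ) : |deriv blobG σ| ≤ 18 := by
  rw [(hasDerivAt_blobG σ).deriv]
  have hm0 := mramp_nonneg hσ
  have hm1 := mramp_le_one σ
  have hj0 := jcut_nonneg σ
  have hj1 := jcut_le_one σ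
  have hj' := abs_deriv_jcut_le σ
  have h1 : |(-6 + 12 * mramp σ) * jcut σ * jcut σ| ≤ 6 := by
    rw [abs_mul, abs_mul, abs_of_nonneg hj0]
    have ha : |-6 + 12 * mramp σ| ≤ 6 := by rw [abs_le]; constructor <;> linarith
    calc |-6 + 12 * mramp σ| * jcut σ * jcut σ ≤ 6 * 1 * 1 := by
          apply mul_le_mul (mul_le_mul ha hj1 hj0 (by norm_num)) hj1 hj0 (by positivity)
      _ = 6 := by norm_num
  have h2 : |(-6 * mramp σ + 6 * mramp σ ^ 2) * deriv jcut σ| ≤ 12 := by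
    rw [abs_mul]
    have hq : |-6 * mramp σ + 6 * mramp σ ^ 2| ≤ 3 / 2 := by
      rw [abs_le]; constructor <;> nlinarith [sq_nonneg (mramp σ - 1 / 2)]
    calc |-6 * mramp σ + 6 * mramp σ ^ 2| * |deriv jcut σ| ≤ 3 / 2 * 8 :=
          mul_le_mul hq hj' (abs_nonneg _) (by norm_num)
      _ = 12 := by norm_num
  exact (abs_add_le _ _).trans (by linarith)

/-- On the flat zone the bound is `6`: `|G′(σ)| = |−6 + 12σ| ≤ 6` for `0 ≤ σ < 1/2`
(`deriv_blobG_of_lt_half`). [folklore] -/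
theorem abs_deriv_blobG_le_of_lt_half {σ : ℝ} (h0 : 0 ≤ σ) (h1 : σ < 1 / 2) : |deriv blobG σ| ≤ 6 := by
  rw [deriv_blobG_of_lt_half h1, abs_le]
  constructor <;> linarith

end Summit.NavierStokesRegularity.FluidComputer.PalasekTowerClayBridge.TinyBlob

end
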